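import Mathlib
import Literature.Analysis.OperatorTheory.ContractiveDetComplexity
import Literature.Analysis.OperatorTheory.ContractiveDeterminantalRepresentations
import HarnessLib
import Summits.ValiantsHypothesis.ValiantsHypothesis.Theorems.ContractivityPricePriceOfContractivityStubStableLiftingTwoColour

/-!
# Crux `PriceOfContractivity` (stmt-ValiantsHypothesis-10583), line `registered` — stub
# `stub_normHalvingOne_twoColour` (norm halving `NH₁`, the TWO-COLOUR case)

Route `ValiantsHypothesis/ContractivityPrice`, crux K1
(`Summit.ValiantsHypothesis.ValiantsHypothesis.Theses.ContractivityPrice.PriceOfContractivity`).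
The open stub `stub_normHalvingOne` (`NH₁`) of the lead's skeleton (line `registered`, birth
rev 8) asks: a Sylvester pencil `1 + diag (X ∘ κ) · K` of size `R` with `‖K‖_op ≤ 2` whose
determinant has no zero on the closed polydisc of radius `2` is re-realized, at size
`R' ≤ 2 ^ ((log₂ n + c) ^ c) · R`, by a matrix `K'` with `‖K'‖_op ≤ 1`.

This file proves the registered stub `stub_normHalvingOne_twoColour`: the case of AT MOST TWO
COLOURS (`κ` takes at most two values), with the published two-variable theorem of
Grinshpan–Kaliuzhnyi-Verbovetskyi–Vinnikov–Woerdeman [GrinshpanEtAl2014, Thm. 2.1] INLINED AS AN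
EXPLICIT HYPOTHESIS of the statement (it is not proved in the tree), verbatim as in the landed
sibling `StableLifting.stub_stableLifting_twoColour`.  In the route's Sylvester form that
hypothesis reads: every non-constant `p : MvPolynomial (Fin 2) ℂ` with `p(0) = 1` and no zero in
the open polydisc `r𝔻²` (`r > 0`) is `det (1 + diag (X ∘ κ) · K)` for some
`K : Matrix (Fin (deg₀ p + deg₁ p)) (Fin (deg₀ p + deg₁ p)) ℂ` with `‖K‖_op ≤ r⁻¹` and a colouring
`κ` with `#κ⁻¹(j) = deg_j p`.

Proof.  With two colours `a, b` the pencil determinant is (a renaming `Fin 2 → σ` of) a bivariate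
polynomial `q(x, y)` with `q(0,0) = 1`, total degree `≤ R` (affine entries, Leibniz) and no zero
on the closed — hence open — radius-`2` bidisc.  If `q` is constant it is `1` and the EMPTY
matrix realizes it (size `0`, norm `0 ≤ 1`).  Otherwise the hypothesis at `r = 2` re-realizes it
as `det (1 + diag (X ∘ κ̂) · K₂)` of size `deg₀ q + deg₁ q ≤ 2R ≤ 2 ^ ((log₂ n + 1) ^ 1) · R` with
`‖K₂‖_op ≤ 1/2 ≤ 1`; renaming back gives the pencil identity over `σ`: the registered conclusion
with `c = 1`.  The general (three or more colours) case `NH₁` is open.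

## References

* [GrinshpanEtAl2014] A. Grinshpan, D. S. Kaliuzhnyi-Verbovetskyi, V. Vinnikov, H. J. Woerdeman,
  Stable and real-zero polynomials in two variables, Multidimens. Syst. Signal Process. 27 (2016)
  1–26 = arXiv:1306.6655: §1 (conventions: `𝔻²`, bidegree `deg p = (deg₁ p, deg₂ p)`,
  representation (1.1) `p = det (I_{|n|} − K Z_n)`, `Z_n = z₁ I_{n₁} ⊕ z₂ I_{n₂}`), §2 first display
  (stability radius `s(p) := max {r > 0 : p(z) ≠ 0, z ∈ r𝔻²}`), Theorem 2.1 (p. 4): "Let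
  `p(z₁, z₂)`, with `p(0, 0) = 1`, be a non-constant bivariate polynomial. Then `p` admits a
  representation (1.1) with `n = deg p` and `‖K‖ = s(p)⁻¹`."
-/

noncomputable section

-- `Summit.<Summit>.<Problem>` repeats `ValiantsHypothesis` by the tree's layout convention (D-0017).
set_option linter.dupNamespace false

namespace Summit.ValiantsHypothesis.ValiantsHypothesis.Theorems.PriceOfContractivity.NormHalvingTwoColour

open Matrix MvPolynomial
open Literature.Analysis.OperatorTheory (eval_det_one_add_diagonal_mul_map_C)
open Summit.ValiantsHypothesis.ValiantsHypothesis.Theorems.PriceOfContractivity.StableLifting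
  (rename_pencil_det totalDegree_pencil_det_le)

/-! ### The two-colour case of `stub_normHalvingOne` -/

/-- **Two-colour case of the norm halving `NH₁` (stub `stub_normHalvingOne`), conditional on
[GrinshpanEtAl2014, Thm. 2.1] taken as the explicit first hypothesis** (Grinshpan,
Kaliuzhnyi-Verbovetskyi, Vinnikov, Woerdeman, *Stable and real-zero polynomials in two variables*,
Thm. 2.1: "Let `p(z₁, z₂)`, with `p(0, 0) = 1`, be a non-constant bivariate polynomial. Then `p`
admits a representation `p = det (I_{|n|} − K Z_n)` with `n = deg p` and `‖K‖ = s(p)⁻¹`", here in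
the route's Sylvester form `det (1 + diag (X ∘ κ) · K)`, `#κ⁻¹(j) = deg_j p`, `‖K‖_op ≤ r⁻¹` for
every zero-free radius `r`).  If the colouring `κ` takes at most two values `a, b`, then the
pencil determinant is (a renaming of) a bivariate polynomial `q` with `q(0) = 1` and no zero on
the polydisc of radius `2`; unless `q` is constant (then `q = 1` and the empty matrix realizes
it, with norm `0 ≤ 1`), the hypothesis at `r = 2` gives `q = det (1 + diag (X ∘ κ̂) K₂)` with
`‖K₂‖_op ≤ 1/2 ≤ 1` at size `deg₀ q + deg₁ q ≤ 2R ≤ 2 ^ ((log₂ n + 1) ^ 1) · R`, and renaming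
back gives the re-realization: the registered conclusion with `c = 1` (the size, cardinality,
degree and `‖K‖_op ≤ 2` hypotheses are not used). [cite: GrinshpanEtAl2014, Thm. 2.1] -/
theorem stub_normHalvingOne_twoColour :
    (∀ (p : MvPolynomial (Fin 2) ℂ) (r : ℝ), 0 < r →
      MvPolynomial.eval (0 : Fin 2 → ℂ) p = 1 → 0 < p.totalDegree →
      (∀ z : Fin 2 → ℂ, (∀ j, ‖z j‖ < r) → MvPolynomial.eval z p ≠ 0) →
      ∃ (K : Matrix (Fin (p.degreeOf 0 + p.degreeOf 1)) (Fin (p.degreeOf 0 + p.degreeOf 1)) ℂ)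
        (κ : Fin (p.degreeOf 0 + p.degreeOf 1) → Fin 2),
        (∀ j : Fin 2, (Finset.univ.filter fun i => κ i = j).card = p.degreeOf j) ∧
        ‖Matrix.toEuclideanCLM (𝕜 := ℂ) K‖ ≤ r⁻¹ ∧
        p = (1 + Matrix.diagonal (fun i => MvPolynomial.X (κ i)) *
              K.map (fun a : ℂ => (MvPolynomial.C a : MvPolynomial (Fin 2) ℂ))).det) →
    ∃ c : ℕ, ∀ (n R : ℕ) {σ : Type} [Fintype σ] (K : Matrix (Fin R) (Fin R) ℂ) (κ : Fin R → σ),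
      (∃ a b : σ, ∀ i, κ i = a ∨ κ i = b) →
      R ≤ 2 ^ ((Nat.log 2 n + c + 2) ^ (c + 2)) →
      Fintype.card σ ≤ n →
      (1 + Matrix.diagonal (fun i => MvPolynomial.X (κ i)) * K.map (fun a : ℂ => (MvPolynomial.C a : MvPolynomial σ ℂ))).det.totalDegree ≤ n →
      ‖Matrix.toEuclideanCLM (𝕜 := ℂ) K‖ ≤ 2 →
      (∀ z : σ → ℂ, (∀ j, ‖z j‖ ≤ 2) → MvPolynomial.eval z (1 + Matrix.diagonal (fun i => MvPolynomial.X (κ i)) * K.map (fun a : ℂ => (MvPolynomial.C a : MvPolynomial σ ℂ))).det ≠ 0) →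
      ∃ R' ≤ 2 ^ ((Nat.log 2 n + c) ^ c) * R, ∃ (K' : Matrix (Fin R') (Fin R') ℂ) (κ' : Fin R' → σ),
        ‖Matrix.toEuclideanCLM (𝕜 := ℂ) K'‖ ≤ 1 ∧
        (1 + Matrix.diagonal (fun i => MvPolynomial.X (κ i)) * K.map (fun a : ℂ => (MvPolynomial.C a : MvPolynomial σ ℂ))).det =
          (1 + Matrix.diagonal (fun i => MvPolynomial.X (κ' i)) * K'.map (fun a : ℂ => (MvPolynomial.C a : MvPolynomial σ ℂ))).det := by
  intro hGKVVW
  classical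
  refine ⟨1, ?_⟩
  intro n R σ _ K κ h2 _hR _hcard _hdeg _hK hz
  obtain ⟨a, b, hab⟩ := h2
  -- comparison maps between `σ` and `Fin 2`
  let f : σ → Fin 2 := fun s => if s = a then 0 else 1
  let g : Fin 2 → σ := fun j => if j = 0 then a else b
  have hgf : ∀ i, g (f (κ i)) = κ i := by
    intro i
    rcases hab i with h | h
    · simp [f, g, h]
    · by_cases hba : b = a
      · simp [f, g, h, hba]
      · simp [f, g, h, hba]
  -- the pencil determinant and its two-variable avatar
  set P := (1 + Matrix.diagonal (fun i => MvPolynomial.X (κ i)) *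
      K.map (fun a : ℂ => (MvPolynomial.C a : MvPolynomial σ ℂ))).det with hP
  set q := (1 + Matrix.diagonal (fun i => MvPolynomial.X (f (κ i))) *
      K.map (fun a : ℂ => (MvPolynomial.C a : MvPolynomial (Fin 2) ℂ))).det with hq
  have hPq : P = MvPolynomial.rename g q := by
    rw [hq, rename_pencil_det]
    simp only [hgf]
    exact hP
  have hq0 : MvPolynomial.eval (0 : Fin 2 → ℂ) q = 1 := by
    rw [hq, eval_det_one_add_diagonal_mul_map_C]
    simp
  have hqz : ∀ zh : Fin 2 → ℂ, (∀ j, ‖zh j‖ < 2) → MvPolynomial.eval zh q ≠ 0 := by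
    intro zh hzh
    have h := hz (zh ∘ f) (fun j => (hzh (f j)).le)
    rw [hP, eval_det_one_add_diagonal_mul_map_C] at h
    rw [hq, eval_det_one_add_diagonal_mul_map_C]
    simpa [Function.comp_def] using h
  have hqdeg : q.totalDegree ≤ R := by
    simpa [Fintype.card_fin] using totalDegree_pencil_det_le K (fun i => f (κ i))
  by_cases hconst : q.totalDegree = 0
  · -- constant case: `q = 1`, realized by the empty matrix
    have hq1 : q = 1 := by
      have hc : q = MvPolynomial.C (q.coeff 0) := totalDegree_eq_zero_iff_eq_C.mp hconst
      rw [hc] at hq0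
      rw [MvPolynomial.eval_C] at hq0
      rw [hc, hq0, MvPolynomial.C_1]
    refine ⟨0, Nat.zero_le _, (0 : Matrix (Fin 0) (Fin 0) ℂ), Fin.elim0, ?_, ?_⟩
    · rw [map_zero, norm_zero]
      exact zero_le_one
    · rw [hPq, hq1, map_one, Matrix.det_isEmpty]
  · -- non-constant case: the two-variable theorem at radius `r = 2`
    obtain ⟨K₂, κq, _hcard, hK₂, hrepr⟩ :=
      hGKVVW q 2 two_pos hq0 (Nat.pos_of_ne_zero hconst) hqz
    have h2 : 2 ≤ 2 ^ ((Nat.log 2 n + 1) ^ 1) := by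
      rw [pow_one, pow_succ]
      calc 2 = 1 * 2 := (one_mul 2).symm
        _ ≤ 2 ^ Nat.log 2 n * 2 := Nat.mul_le_mul_right 2 Nat.one_le_two_pow
    have hN : q.degreeOf 0 + q.degreeOf 1 ≤ 2 ^ ((Nat.log 2 n + 1) ^ 1) * R := by
      have h0 := (degreeOf_le_totalDegree q 0).trans hqdeg
      have h1 := (degreeOf_le_totalDegree q 1).trans hqdeg
      calc q.degreeOf 0 + q.degreeOf 1 ≤ R + R := Nat.add_le_add h0 h1
        _ = 2 * R := (two_mul R).symm
        _ ≤ 2 ^ ((Nat.log 2 n + 1) ^ 1) * R := Nat.mul_le_mul_right R h2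
    refine ⟨q.degreeOf 0 + q.degreeOf 1, hN, K₂, fun i => g (κq i), ?_, ?_⟩
    · exact hK₂.trans (by norm_num)
    · rw [hPq, ← rename_pencil_det g K₂ κq]
      exact congrArg (MvPolynomial.rename g) hrepr

end Summit.ValiantsHypothesis.ValiantsHypothesis.Theorems.PriceOfContractivity.NormHalvingTwoColour
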